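import Literature.MathematicalPhysics.KineticTheory.InfiniteChainSuperstableDynamics
import Literature.MathematicalPhysics.KineticTheory.InfiniteChainObservables
import HarnessLib

/-!
# Momentum reversal of superstable states; reversal symmetry from uniqueness in the regular class

Topic `Literature/MathematicalPhysics/KineticTheory` (companion of `InfiniteChainSuperstableDynamics`
and `InfiniteChainObservables`). For the infinite chain `P : OscillatorChain`, the momentum reversal
`R : (q_x, p_x)_x ↦ (q_x, -p_x)_x` (`momentumReversalZ`) maps DLR Gibbs states to DLR Gibbs states
(`IsChainGibbsMeasure.map_momentumReversalZ`) and shift-invariant states to shift-invariant states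
(`IsShiftInvariant.map_momentumReversalZ`), both in `InfiniteChainObservables`. Here:

* `bmLocalEnergy_momentumReversalZ`: Buttà–Marchioro's local energies `W_{m,k}` (2.4) are even in
  the momenta, hence `HasSuperstabilityEstimate.map_momentumReversalZ`: BM's superstability
  estimate (2.3) passes to `μ ∘ R⁻¹`;
* consequently the REGULAR CLASS at temperature `T` (DLR at `T` + shift-invariant + (2.3)) is
  `R`-stable, and **if it has at most one element then its element is `R`-invariant**
  (`map_momentumReversalZ_eq_of_regular_unique`) and therefore **carries zero mean bond current**,
  `∫ j_x dμ = 0` for every bond (`integral_bondCurrentZ_eq_zero_of_regular_unique`) — the input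
  `⟨j_0⟩_μ = 0` under which the space-summed current autocorrelation of `InfiniteChainDynamics` is
  the matrix element `⟪[J], U_t [J]⟫₀` on Doyon's zero-wavenumber space
  (`ZeroWavenumberData.inner_currentClass_koopman_eq_currentCorrelation`).

Uniqueness in the regular class is a HYPOTHESIS here (the printed 1-D DLR uniqueness theorem for
superstable unbounded spins, Cassandro–Olivieri–Pellegrinotti–Presutti 1978, is not in the tree).
Everything is proved; tagged `[folklore]`. No definitions, no named facts.
-/

noncomputable section

open MeasureTheory Filter Set

namespace Literature.MathematicalPhysics.KineticTheory.HeatConduction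

namespace OscillatorChain

variable (P : OscillatorChain)

/-- **The local energies are even in the momenta**: `W_{m,k}(Rσ) = W_{m,k}(σ)`. [folklore] -/
@[simp] theorem bmLocalEnergy_momentumReversalZ (m : ℤ) (k : ℕ) (σ : ChainConfig) :
    P.bmLocalEnergy m k (momentumReversalZ σ) = P.bmLocalEnergy m k σ := by
  simp only [bmLocalEnergy, momentumReversalZ_apply, neg_sq]

variable {P}

/-- **The superstability estimate (2.3) is invariant under momentum reversal of the state**:
if `μ` satisfies BM's (2.3) then so does `μ ∘ R⁻¹`, with the same constants. [folklore] -/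
theorem HasSuperstabilityEstimate.map_momentumReversalZ {μ : Measure ChainConfig}
    (h : P.HasSuperstabilityEstimate μ) : P.HasSuperstabilityEstimate (μ.map momentumReversalZ) := by
  obtain ⟨hprob, C, lam₀, hC, hlam₀, hb⟩ := h
  refine ⟨Measure.isProbabilityMeasure_map momentumReversalZ.measurable.aemeasurable, C, lam₀, hC,
    hlam₀, fun lam hlam hle m k => ?_⟩
  rw [lintegral_map_equiv]
  simp only [bmLocalEnergy_momentumReversalZ]
  exact hb lam hlam hle m k

/-- **Reversal symmetry from uniqueness in the regular class.** If at temperature `T` any two DLR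
Gibbs states of `P` that are shift-invariant and satisfy BM's superstability estimate coincide, then
every such state `μ` is invariant under momentum reversal, `μ ∘ R⁻¹ = μ` (`μ ∘ R⁻¹` is again in the
regular class). [folklore] -/
theorem map_momentumReversalZ_eq_of_regular_unique {T : ℝ} {μ : Measure ChainConfig}
    (hG : P.IsChainGibbsMeasure T μ) (hS : IsShiftInvariant μ) (hss : P.HasSuperstabilityEstimate μ)
    (huniq : ∀ μ₁ μ₂ : Measure ChainConfig,
      P.IsChainGibbsMeasure T μ₁ → IsShiftInvariant μ₁ → P.HasSuperstabilityEstimate μ₁ →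
      P.IsChainGibbsMeasure T μ₂ → IsShiftInvariant μ₂ → P.HasSuperstabilityEstimate μ₂ → μ₁ = μ₂) :
    μ.map momentumReversalZ = μ :=
  huniq _ _ hG.map_momentumReversalZ hS.map_momentumReversalZ hss.map_momentumReversalZ hG hS hss

/-- **Zero mean current from uniqueness in the regular class**: under the hypotheses of
`map_momentumReversalZ_eq_of_regular_unique`, `∫ j_x dμ = 0` for every bond `x` (the bond current is
odd under `R`). [folklore] -/
theorem integral_bondCurrentZ_eq_zero_of_regular_unique {T : ℝ} {μ : Measure ChainConfig}
    (hG : P.IsChainGibbsMeasure T μ) (hS : IsShiftInvariant μ) (hss : P.HasSuperstabilityEstimate μ)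
    (huniq : ∀ μ₁ μ₂ : Measure ChainConfig,
      P.IsChainGibbsMeasure T μ₁ → IsShiftInvariant μ₁ → P.HasSuperstabilityEstimate μ₁ →
      P.IsChainGibbsMeasure T μ₂ → IsShiftInvariant μ₂ → P.HasSuperstabilityEstimate μ₂ → μ₁ = μ₂)
    (x : ℤ) : ∫ σ, P.bondCurrentZ σ x ∂μ = 0 :=
  integral_bondCurrentZ_eq_zero_of_map_momentumReversalZ_eq P
    (map_momentumReversalZ_eq_of_regular_unique hG hS hss huniq) x

/-- **Momentum reversal preserves an `R`-invariant state** (Mathlib `MeasurePreserving` form, the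
field `measurePreserving` of `ZeroWavenumberData.HasMomentumReversal`). [folklore] -/
theorem measurePreserving_momentumReversalZ_of_map_eq {μ : Measure ChainConfig}
    (h : μ.map momentumReversalZ = μ) : MeasurePreserving momentumReversalZ μ μ :=
  ⟨momentumReversalZ.measurable, h⟩

end OscillatorChain

end Literature.MathematicalPhysics.KineticTheory.HeatConduction

end
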